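import Literature.MathematicalPhysics.QuantumFieldTheory.Balaban1983to89.B9Eq325ProjFormulaZdPerLevels
import Literature.MathematicalPhysics.QuantumFieldTheory.Balaban1983to89.B9Thm311PosDefNearFlatZd
import Literature.MathematicalPhysics.QuantumFieldTheory.Balaban1983to89.B9Thm311FlatPositivityZdPer

/-!
# `Balaban1983to89.B9Thm311PosDefOpenZdPer` — [Balaban1985BackgroundPropagators] Thm 3.11 p. 416 ∕ (3.27) p. 395 ON THE TORUS `T_P` READ ON `ℤᵈ`, NEAR THE FLAT
# BACKGROUND: for the GENUINE four-letter periodic record `opsAllZdPer` (seat dag-n06-b g22: `Δ_a = D*D + Δ′ + D R^per D* + Q*aQ` on `E_𝔤^per(P)`), positivity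
# of `⟨A, Δ_a(U₀)A⟩_per` on `E_𝔤^per(P) ∖ 0` — hence `RegularAtHPer` («`G_𝔤^per(U₀) = (Δ_a)⁻¹` exists», the `InvAtHIPer` binder's content) — PROPAGATES from `U₀ = 1` to
# ALL unitary `P`-periodic backgrounds of the regime class NEAR `U₀ = 1`: the openness engine of `B9Thm311PosDefOpenZd` (this lineage, g3) on the periodic carrier,
# fed by the continuity of the record's `D R^per(U₀) D*` letter (`B9Eq325ProjFormulaZdPerLevels`, the (3.25) chain with the averaged transporters unitary up to the
# truncation level `m` only) and of `Q*aQ` ∕ `Δ′` ∕ `D*D` (g3); at the torus member of record the flat positivity is dag-n06-b g23's `B9Thm311FlatPositivityZdPer`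
# (BY NAME), so NO displayed positivity hypothesis remains there; the periodic twin of `B9Thm311PosDefNearFlatZd`

statement-level skeleton of published theorems with citation tags; proofs where landed; nothing here is a claim about the
Yang–Mills mass gap

`[Balaban1985BackgroundPropagators]` ("B9", CMP **99** (1985) 389–434) Thm 3.11 p. 416: *«There exist constants M₀, α₀′ such that for M ≥ M₀, Mα₀ ≤ α₀′ … the
operators Δ′_a, G′, Q′G′²Q′*, (Q′G′²Q′*)⁻¹, Δ_a, G are positive definite … uniformly in U, Ω_j»*; (3.26)–(3.27) p. 395; (3.25) p. 394.  `[Balaban1985RegularSpaces]`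
p. 77 *«Ω_j = T_η»*, (1.58) p. 86.  PDF held: `paper:balaban1985-cmp99-background-propagators` pp. 394–395, 416.

CITATION HEADER (lean-in-tree rule).  Cell `pub-ymgap` (YM Track A), DAG node N06 = [B9], width seat `pub-ymgap-dag-n06-w4` (g6), the (β′-PERIODIC) road (director-ym
№217 (1)); dag-n06-b g22's word «(3.25) chain ⟹ `InvAtHIPer` inhabitant near `U₀ = 1` — yours, GO».  WHY: the periodic socket for the genuine torus record follows from
three displayed binders, the first being `InvAtHIPer` (Thm 3.11); its content at a member is `RegularAtHPer` of the record at the unitary periodic backgrounds of the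
class.  THIS FILE proves it for all such backgrounds NEAR THE FLAT ONE (member- and class-dependent neighbourhood, product topology), from the flat positivity —
displayed (`hpos1`) at a general member, DISCHARGED at the torus member of record by dag-n06-b g23's `B9Thm311FlatPositivityZdPer.bondPairPer_deltaAOf_opsAllZdPer_one_pos`
(the flat Hodge kernel of dag-n06-w3 g6 `B9Thm311FlatKernelZdPer` + the `R`∕`Q` halves).  Every tool is imported BY NAME: the engine
`posDef_eventually_of_continuousWithinAt`, `continuousWithinAt_QQZdP`, `continuousWithinAt_Jcur_add_DpZd` (g3), the `DRDs`-letter continuity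
`continuousAt_covDerivFwd_projRPer_covDivB_le` (this seat's (3.25) chain, hypothesis-exact edition: `Ū₀ʲ(Γ)` unitary for `j ≤ m`), the doors
`linearOnDomAt_opsAllZdPer_univ` ∕ `regularAtHPer_opsAllZdPer_of_pos` (dag-n06-b); nothing is re-declared.

WHAT IS PROVED (kernel, 0 sorry; theorems only — no `def`, no `instance`, no `notation`).
* §1 ★★ `bondPairPer_pos_eventually` (THE ENGINE ON THE TORUS: positivity of `⟨A, Δ_a(U₀)A⟩_per` on a subspace `W ⊆ E_𝔤^per(P)` is OPEN in the background within any
  set `𝒰` on which `Δ_a` is linear and its letters are continuous at the base point — `P ≠ 0`, finite-dimensional fibre), `bondPairPer_pos_eventually_domSubHPer`.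
* §2 ★★ `regularPrimePer_eventually_one` (the scalar regime is OPEN at the flat background: `Δ′_a(U₀)` is invertible on `L²(T_P)` for all `U₀` near `1` within any
  set — weights `a ≥ 0` with an active non-empty level-periodic `Λ_{j₀}`; the engine on `perSub P` with §3 of `B9Eq324DeltaPrimeAZdPer`).
* §3 ★★ `lettersContinuousWithinAt_opsAllZdPer_one` (ALL FOUR LETTERS of the genuine periodic `Δ_a(U₀)` are continuous in `U₀` within the regime set at `U₀ = 1`, on
  `E_𝔤^per(P)`: `D*D + Δ′` (g3), `D R^per D*` (the (3.25) chain, on the subtype of the regime set), `Q*aQ` (g3's `continuousWithinAt_QQZdP`)).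
* §4 ★★★ `bondPairPer_pos_eventually_one_opsAllZdPer` and ★★★ `regularAtHPer_eventually_one_opsAllZdPer` (THM 3.11 ∕ (3.27) ON THE TORUS NEAR THE FLAT BACKGROUND FOR
  THE GENUINE RECORD: given the flat positivity `hpos1`, for all unitary `P`-periodic `U₀` of the regime class `𝒰` near `1`, `⟨A, Δ_a(U₀)A⟩_per > 0` on `E_𝔤^per(P) ∖ 0`
  and `RegularAtHPer` holds — `G_𝔤^per(U₀)` exists and the record's `Gop` inverts `Δ_a(U₀)` there), ★★★ `exists_delta_regularAtHPer_opsAllZdPer` (the SUP-NORM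
  reading: one `δ > 0` for all `U₀ ∈ 𝒰` that are `δ`-close to `1` at every bond).
* §5 ★★★ `regularAtHPer_eventually_one_torusIdx` (AT THE TORUS MEMBER OF RECORD `B8Thm2TorusMember.torusIdx` — `Ω_j = ℤᵈ`, `Λ = torusLam`, `Λb = torusLamb` —
  the geometric hypotheses (level periodicity, non-empty top level, one active level ⟹ `Q′*` injective, box law) AND the flat positivity (dag-n06-b g23, BY NAME)
  are DISCHARGED: only the regime set, `2 ≤ L` and `Lᵐ ∣ P` remain).
* §6 (v1.1) ★★★ `regularAtHPer_eventually_one_torusIdx_canonical` (the CANONICAL regime set `{unitary, P-periodic, class (1.7) of the member, Ū₀ʲ(Γ) unitary for j ≤ m}`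
  written out — it contains `1` by `reg17_one` ∕ `bgT_one` — so NO displayed binder is left: hypotheses `2 ≤ L`, `Lᵐ ∣ P`, `τ` only), ★★★
  `exists_delta_regularAtHPer_torusIdx_canonical` (the sup-norm `δ` reading of the same).

HONEST SCOPE.  (i) Openness and continuity only: the neighbourhood of `U₀ = 1` is member- and class-dependent (product topology on backgrounds), NOT print's
uniform `M₀, α₀′`; no estimate of [B9] (Thm 3.1 ∕ 3.3 ∕ (3.42) NOT proved).  (ii) The flat positivity `hpos1` of the genuine periodic `Δ_a(1)` on `E_𝔤^per(P)` is a
DISPLAYED hypothesis at a general member (§4) and DISCHARGED at the torus member of record (§5, all-torus classes `torusLam ∕ torusLamb`).  (iii) The regime set `𝒰`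
displays: unitary bonds, `P`-periodicity, averaged transporters `Ū₀ʲ(Γ)` unitary FOR `j ≤ m` (`[B7]` Prop. 2's output on a small-field class, `B7Prop2Explicit.avgIter_mem`),
the `Reg17` class of the `Q*aQ` letter, and `Q′*`-injectivity on `L²(𝔅_P)` (one active level suffices, `B9Eq325QGGQInvZdPer`); `1 ∈ 𝒰` is required.  (iv) Count-neutral; N05 ∕ N06 NOT discharged; K1⁹
`stmt-QuantumFields-27364` NOT closed; Theorem 3.11 proved only NEAR `U₀ = 1` per member; one finite `𝕋⁴` programme at fixed `ε`, Bałaban as printed; R4 closes only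
the conditional finite-`𝕋⁴` rung `BalabanLadder.UV` — nothing continuum ∕ ℝ⁴ ∕ OS ∕ mass gap ∕ Clay.  Unit `pub-ymgap-dag-n06-w4` (g6), 2026-08-28.
-/

noncomputable section

namespace Literature.MathematicalPhysics.QuantumFieldTheory.Balaban1983to89.B9Thm311PosDefOpenZdPer

open Filter Topology
open B7Prop1Explicit
open B7Prop2Explicit (unitaryUnits avgIter)
open B7Prop1Local (InBox loK bondHiK)
open B8Eq119TwistedAxial (bgT)
open B8LeafModelZd (ZdIdx)
open T4TermwiseTorus (IsPeriodic box)
open B9SupplySockB9P3ZdLetters (OpsZd deltaAOf)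
open B9SupplySockB9P3ZdGammaInAkDpZd (withDpZd)
open B9Eq316AveragingTransposeZd (tauForm tauForm_apply Reg17 alphaQ)
open B9Eq316AveragingTransposeZdPrinted (QQZdP withQQP)
open B9Eq327GreenZd (LinearOnDomAt)
open B9Eq327GreenZdHermPer (domSubHPer mem_domSubHPer_iff finiteDimensional_domSubHPer RegularAtHPer bondPairPer mem_domSub_univ)
open B9Eq321LandauProjectionZdPer (perSub formPer finiteDimensional_perSub)
open B9Eq324DeltaPrimeAZdPer (deltaPrimeAPer RegularPrimePer bijective_of_form_pos formPer_deltaPrimeAPer_one_self_pos regularPrimePer_one)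
open B9Eq325QGGQInvZdPer (QprimeStarPerInjective)
open B9Eq325ProjContinuityZdPer (continuousAt_deltaPrimeAPer)
open B9Eq325ProjFormulaZdPerLevels (continuousAt_covDerivFwd_projRPer_covDivB_le)
open B9Eq325ProjContinuityZd (continuousAt_bgT continuousAt_bgT_one)
open B9Thm311PosDefOpenZd (posDef_eventually_of_continuousWithinAt continuous_tauForm_right)
open B9Thm311PosDefNearFlatZd (continuousWithinAt_QQZdP)
open B9SupplySockB9P3ZdAllLettersZdPer (opsLandauPer opsAllZdPer deltaAOf_opsAllZdPer_apply linearOnDomAt_opsAllZdPer_univ regularAtHPer_opsAllZdPer_of_pos)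

-- `Site` alone could resolve to the torus sites of `Setup.lean`; re-export the `ℤ^d` sites of `B7Prop1Explicit`.
export B7Prop1Explicit (Site)

variable {d : ℕ} {𝔸 : Type*} [CStarAlgebra 𝔸]

/-! ## §1  The engine on the torus: positivity of `⟨A, Δ_a(U₀)A⟩_per` is open in the background -/

section Engine

variable [FiniteDimensional ℝ 𝔸] (τ : 𝔸 →ₗ[ℂ] ℂ) {P : ℕ} [NeZero P]

/-- ★★ **POSITIVITY OF `⟨A, Δ_a(U₀)A⟩_{τ,per}` ON A FIELD CLASS IS OPEN IN THE BACKGROUND ON THE TORUS** (`P ≠ 0`, finite-dimensional fibre).  Let `W ⊆ E_𝔤^per(P)` be a real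
subspace of periodic Hermitian bond fields, `𝒰` a set of backgrounds containing `U₁`.  If `Δ_a(U₀)` is (the restriction of) an ℝ-linear map for every `U₀ ∈ 𝒰`, its
letters are continuous in `U₀` within `𝒰` at `U₁` on `W` at every bond, and `0 < ⟨A, Δ_a(U₁)A⟩_per` for every `0 ≠ A ∈ W`, then `0 < ⟨A, Δ_a(U₀)A⟩_per` for every
`0 ≠ A ∈ W` and ALL `U₀ ∈ 𝒰` NEAR `U₁` — Theorem 3.11's «positive definite» propagates from one background to its neighbours (the Dirichlet twin is
`B9Thm311PosDefOpenZd.bondPair_pos_eventually`). [cite: Balaban1985BackgroundPropagators, Thm 3.11 p.416, (3.26)–(3.27) p.395; Balaban1985RegularSpaces, p.77 («Ω_j = T_η»)] -/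
theorem bondPairPer_pos_eventually {η : ℝ} {o : OpsZd d 𝔸} {W : Submodule ℝ (Site d → Fin d → 𝔸)} (hW : W ≤ domSubHPer (d := d) (𝔸 := 𝔸) P)
    {𝒰 : Set (Site d → Fin d → 𝔸ˣ)} {U₁ : Site d → Fin d → 𝔸ˣ} (hU₁ : U₁ ∈ 𝒰)
    (hlin : ∀ U₀ ∈ 𝒰, LinearOnDomAt η o (Set.univ : Set (Site d)) U₀)
    (hcont : ∀ A ∈ W, ∀ (y : Site d) (μ : Fin d), ContinuousWithinAt (fun U₀ => deltaAOf η o U₀ A y μ) 𝒰 U₁)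
    (hpos : ∀ A ∈ W, A ≠ 0 → 0 < bondPairPer τ P A (deltaAOf η o U₁ A)) :
    ∀ᶠ U₀ in 𝓝[𝒰] U₁, ∀ A ∈ W, A ≠ 0 → 0 < bondPairPer τ P A (deltaAOf η o U₀ A) := by
  classical
  haveI : FiniteDimensional ℝ (domSubHPer (d := d) (𝔸 := 𝔸) P) := finiteDimensional_domSubHPer (d := d) (𝔸 := 𝔸) P
  haveI : FiniteDimensional ℝ W := Submodule.finiteDimensional_of_le hW
  choose! T hT using hlin
  -- evaluation at a bond, as a linear map
  let ev : Site d × Fin d → ((Site d → Fin d → 𝔸) →ₗ[ℝ] 𝔸) := fun b =>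
    (LinearMap.proj (R := ℝ) (φ := fun _ : Fin d => 𝔸) b.2).comp (LinearMap.proj (R := ℝ) (φ := fun _ : Site d => Fin d → 𝔸) b.1)
  -- the bilinear forms `q U₀ (A, B) = Σ_μ Σ_{x ∈ cell} Re τ(A(x,μ)* (T U₀ B)(x,μ))` on `W`
  let q : (Site d → Fin d → 𝔸ˣ) → W →ₗ[ℝ] W →ₗ[ℝ] ℝ := fun U =>
    ∑ μ : Fin d, ∑ x ∈ box (d := d) P, (tauForm τ).compl₁₂ ((ev (x, μ)).comp W.subtype) ((ev (x, μ)).comp ((T U).comp W.subtype))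
  have hq : ∀ U (A B : W), q U A B = ∑ μ : Fin d, ∑ x ∈ box (d := d) P, tauForm τ ((A : Site d → Fin d → 𝔸) x μ) (T U B x μ) := by
    intro U A B
    simp only [q, LinearMap.sum_apply, LinearMap.compl₁₂_apply, LinearMap.comp_apply, Submodule.subtype_apply, ev, LinearMap.proj_apply]
  -- on `𝒰` the diagonal is the periodic pairing
  have hdiag : ∀ U ∈ 𝒰, ∀ A : W, q U A A = bondPairPer τ P (A : Site d → Fin d → 𝔸) (deltaAOf η o U A) := by
    intro U hU A
    rw [hq, bondPairPer]
    refine Finset.sum_congr rfl fun μ _ => Finset.sum_congr rfl fun x _ => ?_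
    rw [tauForm_apply, hT U hU A (mem_domSub_univ _)]
  -- the entries are continuous within `𝒰` at `U₁`
  have hcq : ∀ A B : W, ContinuousWithinAt (fun U => q U A B) 𝒰 U₁ := by
    intro A B
    have h : ContinuousWithinAt
        (fun U => ∑ μ : Fin d, ∑ x ∈ box (d := d) P, tauForm τ ((A : Site d → Fin d → 𝔸) x μ) (deltaAOf η o U B x μ)) 𝒰 U₁ := by
      refine tendsto_finsetSum _ fun μ _ => tendsto_finsetSum _ fun x _ => ?_
      exact ((continuous_tauForm_right τ ((A : Site d → Fin d → 𝔸) x μ)).tendsto _).comp (hcont B B.2 x μ)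
    refine h.congr (fun U hU => ?_) ?_
    · rw [hq]
      exact Finset.sum_congr rfl fun μ _ => Finset.sum_congr rfl fun x _ => by rw [hT U hU B (mem_domSub_univ _)]
    · rw [hq]
      exact Finset.sum_congr rfl fun μ _ => Finset.sum_congr rfl fun x _ => by rw [hT U₁ hU₁ B (mem_domSub_univ _)]
  -- positivity at `U₁`
  have hposq : ∀ A : W, A ≠ 0 → 0 < q U₁ A A := by
    intro A hA
    rw [hdiag U₁ hU₁ A]
    exact hpos A A.2 fun h => hA (Subtype.ext h)
  have hev := posDef_eventually_of_continuousWithinAt q 𝒰 U₁ hcq hposq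
  filter_upwards [hev, eventually_mem_nhdsWithin] with U hU hU𝒰
  intro A hA hA0
  have h := hU ⟨A, hA⟩ fun h => hA0 (congrArg Subtype.val h)
  rwa [hdiag U hU𝒰] at h

/-- ★★ **THE `E_𝔤^per(P)` READING**: positivity of `⟨A, Δ_a(U₀)A⟩_per` on `E_𝔤^per(P) ∖ 0` is open in the background.
[cite: Balaban1985BackgroundPropagators, Thm 3.11 p.416, (3.26)–(3.27) p.395] -/
theorem bondPairPer_pos_eventually_domSubHPer {η : ℝ} {o : OpsZd d 𝔸}
    {𝒰 : Set (Site d → Fin d → 𝔸ˣ)} {U₁ : Site d → Fin d → 𝔸ˣ} (hU₁ : U₁ ∈ 𝒰)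
    (hlin : ∀ U₀ ∈ 𝒰, LinearOnDomAt η o (Set.univ : Set (Site d)) U₀)
    (hcont : ∀ A ∈ domSubHPer (d := d) (𝔸 := 𝔸) P, ∀ (y : Site d) (μ : Fin d), ContinuousWithinAt (fun U₀ => deltaAOf η o U₀ A y μ) 𝒰 U₁)
    (hpos : ∀ A ∈ domSubHPer (d := d) (𝔸 := 𝔸) P, A ≠ 0 → 0 < bondPairPer τ P A (deltaAOf η o U₁ A)) :
    ∀ᶠ U₀ in 𝓝[𝒰] U₁, ∀ A ∈ domSubHPer (d := d) (𝔸 := 𝔸) P, A ≠ 0 → 0 < bondPairPer τ P A (deltaAOf η o U₀ A) :=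
  bondPairPer_pos_eventually τ le_rfl hU₁ hlin hcont hpos

end Engine

/-! ## §2  The scalar regime is open at the flat background: `Δ′_a(U₀)` invertible on `L²(T_P)` for `U₀` near `1` -/

section ScalarRegime

variable [FiniteDimensional ℝ 𝔸] (τ : 𝔸 →ₗ[ℂ] ℂ) {P L : ℕ} [NeZero P] [NeZero L] {η : ℝ} {m : ℕ} {a : ℕ → ℝ} {Λs : ℕ → Set (Site d)}

/-- ★★ **THE SCALAR REGIME IS OPEN AT THE FLAT BACKGROUND**: `⟨f, Δ′_a(U₀)f⟩_{T_P} > 0` on `L²(T_P) ∖ 0` — hence `Δ′_a(U₀)` invertible (`RegularPrimePer`) — for ALL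
backgrounds `U₀` NEAR `1` within any set `𝒰 ∋ 1` (`η ≠ 0`, `L ≥ 1`, `a ≥ 0`, `Lᵐ ∣ P`, one active non-empty level-periodic `Λ_{j₀}`, tracial faithful `τ`): the engine on
`L²(T_P)` with the flat positivity of `B9Eq324DeltaPrimeAZdPer` and the continuity of `Δ′_a(U₀)` in `U₀` (at the flat background every averaged transporter is
continuous). [cite: Balaban1985BackgroundPropagators, Thm 3.11 p.416 («Δ′_a, G′ … positive definite»), (3.24) p.394] -/
theorem regularPrimePer_eventually_one (hη : η ≠ 0) (hL : 1 ≤ L) (hτt : ∀ a b : 𝔸, τ (a * b) = τ (b * a))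
    (hτp : ∀ a : 𝔸, a ≠ 0 → 0 < (τ (star a * a)).re) (hP : L ^ m ∣ P) (ha : ∀ j, 0 ≤ a j) {j₀ : ℕ} (hj₀ : j₀ ≤ m) (haj₀ : 0 < a j₀)
    (hΛ₀ : IsPeriodic (P / L ^ j₀) fun y => y ∈ Λs j₀) (hne : (Λs j₀).Nonempty) (𝒰 : Set (Site d → Fin d → 𝔸ˣ)) :
    ∀ᶠ U₀ in 𝓝[𝒰] (1 : Site d → Fin d → 𝔸ˣ),
      (∀ f : perSub (𝔸 := 𝔸) (d := d) P, f ≠ 0 → 0 < formPer τ P f (deltaPrimeAPer L U₀ η m a Λs P f)) ∧ RegularPrimePer L U₀ η m a Λs P := by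
  haveI := finiteDimensional_perSub (𝔸 := 𝔸) (d := d) P
  -- the bilinear forms `q U (f, g) = ⟨f, Δ′_a(U) g⟩`
  let q : (Site d → Fin d → 𝔸ˣ) → perSub (𝔸 := 𝔸) (d := d) P →ₗ[ℝ] perSub (𝔸 := 𝔸) (d := d) P →ₗ[ℝ] ℝ := fun U =>
    (formPer τ P).compl₂ (deltaPrimeAPer L U η m a Λs P)
  have hq : ∀ U (f g : perSub (𝔸 := 𝔸) (d := d) P), q U f g = formPer τ P f (deltaPrimeAPer L U η m a Λs P g) := fun U f g => rfl
  -- continuity of the entries at `1` (all averaged transporters are continuous at the flat background)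
  have hbgT : ∀ j, j < m + 1 → ∀ (y x : Site d), ContinuousAt (fun U₀ : Site d → Fin d → 𝔸ˣ => bgT L U₀ j y x) 1 :=
    fun j _ y x => continuousAt_bgT_one L j y x
  have hcq : ∀ f g : perSub (𝔸 := 𝔸) (d := d) P, ContinuousWithinAt (fun U => q U f g) 𝒰 1 := by
    intro f g
    have hΔ : ContinuousAt (fun U₀ : Site d → Fin d → 𝔸ˣ => deltaPrimeAPer L U₀ η m a Λs P g) 1 :=
      continuousAt_deltaPrimeAPer (U := fun U₀ : Site d → Fin d → 𝔸ˣ => U₀) continuousAt_id hbgT η a continuousAt_const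
    have hφ : Continuous fun v : perSub (𝔸 := 𝔸) (d := d) P => formPer τ P f v := (formPer τ P f).continuous_of_finiteDimensional
    exact (hφ.continuousAt.comp hΔ).continuousWithinAt
  have hposq : ∀ f : perSub (𝔸 := 𝔸) (d := d) P, f ≠ 0 → 0 < q 1 f f :=
    fun f hf => formPer_deltaPrimeAPer_one_self_pos τ hη hL hτt hτp hP ha hj₀ haj₀ hΛ₀ hne hf
  have hev := posDef_eventually_of_continuousWithinAt q 𝒰 1 hcq hposq
  filter_upwards [hev] with U hU
  exact ⟨hU, bijective_of_form_pos τ hU⟩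

end ScalarRegime

/-! ## §3  All four letters of the genuine periodic `Δ_a(U₀)` are continuous within the regime at the flat background -/

section Letters

variable [FiniteDimensional ℝ 𝔸] [Nontrivial 𝔸] (τ : 𝔸 →ₗ[ℂ] ℂ) (hτp : ∀ a : 𝔸, a ≠ 0 → 0 < (τ (star a * a)).re)
  (hτt : ∀ a b : 𝔸, τ (a * b) = τ (b * a)) (hτs : ∀ a : 𝔸, τ (star a) = starRingEnd ℂ (τ a)) {L P : ℕ} [NeZero P] [NeZero L]

include hτp hτt hτs in
/-- ★★ **ALL FOUR LETTERS OF THE GENUINE PERIODIC `Δ_a(U₀)` ARE CONTINUOUS IN THE BACKGROUND, WITHIN THE REGIME SET, AT `U₀ = 1`, ON `E_𝔤^per(P)`.**  Member data: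
the periodic member `(M, i, m)` with `Lᵐ ∣ P`, level-periodic constraint sets `i.Λs m j`, `1 ≤ L`; regime set `𝒰 ∋ 1` of UNITARY `P`-PERIODIC backgrounds in the `Reg17`
class of the `Q*aQ` letter whose averaged transporters `Ū₀ʲ(Γ)` are unitary for `j ≤ m`, on which the scalar regime `RegularPrimePer` (for weights `a`) holds and `Q′*`
is injective.  Letters: `D*D + Δ′` (`continuousWithinAt_Jcur_add_DpZd`), `D R^per(U₀) D*` (`continuousAt_covDerivFwd_projRPer_covDivB_le` on the subtype `𝒰`), `Q*aQ`
(`continuousWithinAt_QQZdP`). [cite: Balaban1985BackgroundPropagators, (3.26) p.395, (3.10) p.392, (3.16) p.393, (3.20)–(3.25) p.394; Balaban1985RegularSpaces, (1.7) p.77, p.77 («Ω_j = T_η»)] -/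
theorem lettersContinuousWithinAt_opsAllZdPer_one (ΛbP : ℕ → ℕ → Set (Site d × Fin d)) (ops₀ : ℝ → ZdIdx d L → ℕ → OpsZd d 𝔸) (M : ℝ) (i : ZdIdx d L)
    (m : ℕ) (a : ℕ → ℝ) (hL : 1 ≤ L) (hP : L ^ m ∣ P) (hΛ : ∀ j, j ≤ m → IsPeriodic (P / L ^ j) fun y => y ∈ i.Λs m j)
    {𝒰 : Set (Site d → Fin d → 𝔸ˣ)} (h1 : (1 : Site d → Fin d → 𝔸ˣ) ∈ 𝒰)
    (hunit : ∀ U₀ ∈ 𝒰, ∀ (x : Site d) (κ : Fin d), U₀ x κ ∈ unitaryUnits 𝔸) (hper : ∀ U₀ ∈ 𝒰, IsPeriodic P U₀)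
    (hreg : ∀ U₀ ∈ 𝒰, Reg17 L m i.Ω (alphaQ d L / (L : ℝ) ^ 2) U₀)
    (hT : ∀ U₀ ∈ 𝒰, ∀ j, j ≤ m → ∀ (x y : Site d), bgT L U₀ j x y ∈ unitaryUnits 𝔸)
    (hregP : ∀ U₀ ∈ 𝒰, RegularPrimePer L U₀ i.η m a (i.Λs m) P) (hinj : ∀ U₀ ∈ 𝒰, QprimeStarPerInjective (𝔸 := 𝔸) (d := d) P L U₀ m (i.Λs m))
    {A : Site d → Fin d → 𝔸} (hA : A ∈ domSubHPer (d := d) (𝔸 := 𝔸) P) (y : Site d) (μ : Fin d) :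
    ContinuousWithinAt (fun U₀ => deltaAOf i.η (opsAllZdPer τ L P ΛbP ops₀ M i m) U₀ A y μ) 𝒰 1 := by
  have hAp : IsPeriodic P A := ((mem_domSubHPer_iff P A).1 hA).1
  have hAh : ∀ (w : Site d) (κ : Fin d), IsSelfAdjoint (A w κ) := ((mem_domSubHPer_iff P A).1 hA).2
  -- the `D R^per D*` letter: continuity on the subtype `𝒰` at `⟨1, h1⟩`
  have h3 : ContinuousWithinAt
      (fun U₀ => B8Ineq132.covDerivFwd i.η U₀ μ (B9Eq321LandauProjectionZdPer.projRPer τ P L m i.η (i.Λs m) U₀ (B8Eq138LandauZd.covDivB i.η U₀ A)) y) 𝒰 1 := by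
    rw [continuousWithinAt_iff_continuousAt_restrict _ h1]
    have hval : ContinuousAt (fun z : 𝒰 => (z : Site d → Fin d → 𝔸ˣ)) ⟨1, h1⟩ := continuous_subtype_val.continuousAt
    have hbgT : ∀ j, j < m + 1 → ∀ (y' x' : Site d), ContinuousAt (fun z : 𝒰 => bgT L (z : Site d → Fin d → 𝔸ˣ) j y' x') ⟨1, h1⟩ := by
      intro j _ y' x'
      refine continuousAt_bgT L hval j (fun i' _ q κ r => ?_) y' x'
      show ‖((Wcx L (avgIter L (1 : Site d → Fin d → 𝔸ˣ) i') q κ (boxVec L r) : 𝔸ˣ) : 𝔸) - 1‖ < 1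
      rw [B8Ineq132.avgIter_one, B8Ineq130.Wcx_one, Units.val_one, sub_self, norm_zero]
      exact zero_lt_one
    exact continuousAt_covDerivFwd_projRPer_covDivB_le τ i.η a hval hbgT hτt hτs hτp hL (fun z => hunit z.1 z.2) (fun z => hT z.1 z.2)
      (fun z => hper z.1 z.2) hP hΛ (fun z => hregP z.1 z.2) (fun z => hinj z.1 z.2) hAp hAh μ y
  have h4 := continuousWithinAt_QQZdP τ L ΛbP i m hreg hL A y μ
  have h12 := B9Eq310DeltaPrimeContinuityZd.continuousWithinAt_Jcur_add_DpZd i.η A y μ 𝒰 (1 : Site d → Fin d → 𝔸ˣ)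
  have h := (h12.add h3).add h4
  refine h.congr (fun U₀ _ => ?_) ?_ <;> simp only [deltaAOf_opsAllZdPer_apply, Pi.add_apply]

end Letters

/-! ## §4  Theorem 3.11 ∕ (3.27) on the torus near the flat background for the genuine record -/

section NearFlat

variable [FiniteDimensional ℝ 𝔸] [Nontrivial 𝔸] (τ : 𝔸 →ₗ[ℂ] ℂ) (hτp : ∀ a : 𝔸, a ≠ 0 → 0 < (τ (star a * a)).re)
  (hτt : ∀ a b : 𝔸, τ (a * b) = τ (b * a)) (hτs : ∀ a : 𝔸, τ (star a) = starRingEnd ℂ (τ a)) {L P : ℕ} [NeZero P] [NeZero L]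

include hτp hτt hτs in
/-- ★★★ **THEOREM 3.11's POSITIVITY ON THE TORUS, NEAR THE FLAT BACKGROUND, FOR THE GENUINE PERIODIC RECORD.**  Member `(M, i, m)` with `η ≠ 0`, `2 ≤ L`, `Lᵐ ∣ P`,
level-periodic constraint sets `i.Λs m j` with the top set `i.Λs m j₀` NON-EMPTY for some `j₀ ≤ m` (print: `Λ_m` = the whole top lattice), the box law of the `Q*aQ`
class; regime set `𝒰 ∋ 1` of unitary `P`-periodic backgrounds in the `Reg17` class with `Ū₀ʲ(Γ)` unitary for `j ≤ m` and `Q′*` injective on `L²(𝔅_P)`; faithful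
Hermitian tracial `τ`, finite-dimensional fibre.  IF `⟨A, Δ_a(1)A⟩_per > 0` on `E_𝔤^per(P) ∖ 0` (the flat positivity, `hpos1`), THEN `⟨A, Δ_a(U₀)A⟩_per > 0` on
`E_𝔤^per(P) ∖ 0` for ALL `U₀ ∈ 𝒰` NEAR `1`.  («the operators Δ_a, G are positive definite» — here with a member-dependent neighbourhood instead of print's uniform
`α₀′`.) [cite: Balaban1985BackgroundPropagators, Thm 3.11 p.416, (3.26) p.395; Balaban1985RegularSpaces, (1.7) p.77, p.77 («Ω_j = T_η»)] -/
theorem bondPairPer_pos_eventually_one_opsAllZdPer (hL2 : 2 ≤ L) (ΛbP : ℕ → ℕ → Set (Site d × Fin d))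
    (ops₀ : ℝ → ZdIdx d L → ℕ → OpsZd d 𝔸) (M : ℝ) (i : ZdIdx d L) (m : ℕ) (hη : i.η ≠ 0) (hP : L ^ m ∣ P)
    (hΛ : ∀ j, j ≤ m → IsPeriodic (P / L ^ j) fun y => y ∈ i.Λs m j) {j₀ : ℕ} (hj₀ : j₀ ≤ m) (hne : (i.Λs m j₀).Nonempty)
    (hbox : ∀ j, 1 ≤ j → j ≤ m → ∀ c ∈ ΛbP m j, ∀ x, InBox (loK L j c.1) (bondHiK L j c.1 c.2) x → x ∈ i.Ω (j - 1))
    {𝒰 : Set (Site d → Fin d → 𝔸ˣ)} (h1 : (1 : Site d → Fin d → 𝔸ˣ) ∈ 𝒰)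
    (hunit : ∀ U₀ ∈ 𝒰, ∀ (x : Site d) (κ : Fin d), U₀ x κ ∈ unitaryUnits 𝔸) (hper : ∀ U₀ ∈ 𝒰, IsPeriodic P U₀)
    (hreg : ∀ U₀ ∈ 𝒰, Reg17 L m i.Ω (alphaQ d L / (L : ℝ) ^ 2) U₀)
    (hT : ∀ U₀ ∈ 𝒰, ∀ j, j ≤ m → ∀ (x y : Site d), bgT L U₀ j x y ∈ unitaryUnits 𝔸)
    (hinj : ∀ U₀ ∈ 𝒰, QprimeStarPerInjective (𝔸 := 𝔸) (d := d) P L U₀ m (i.Λs m))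
    (hpos1 : ∀ A ∈ domSubHPer (d := d) (𝔸 := 𝔸) P, A ≠ 0 → 0 < bondPairPer τ P A (deltaAOf i.η (opsAllZdPer τ L P ΛbP ops₀ M i m) 1 A)) :
    ∀ᶠ U₀ in 𝓝[𝒰] (1 : Site d → Fin d → 𝔸ˣ),
      ∀ A ∈ domSubHPer (d := d) (𝔸 := 𝔸) P, A ≠ 0 → 0 < bondPairPer τ P A (deltaAOf i.η (opsAllZdPer τ L P ΛbP ops₀ M i m) U₀ A) := by
  have hL : 1 ≤ L := le_trans (by norm_num) hL2
  -- weights `a ≡ 1` for the scalar regime of the (3.25) reading of `R^per`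
  set a : ℕ → ℝ := fun _ => 1 with ha
  have ha0 : ∀ j, 0 ≤ a j := fun _ => zero_le_one
  have haj₀ : 0 < a j₀ := zero_lt_one
  -- the scalar regime holds on a `𝓝[𝒰] 1`-large set; restrict `𝒰` to it
  have hR := regularPrimePer_eventually_one τ hη hL hτt hτp hP ha0 hj₀ haj₀ (hΛ j₀ hj₀) hne 𝒰 (η := i.η) (a := a) (Λs := i.Λs m)
  set T : Set (Site d → Fin d → 𝔸ˣ) := {U₀ | RegularPrimePer L U₀ i.η m a (i.Λs m) P} with hTdef
  have hTmem : T ∈ 𝓝[𝒰] (1 : Site d → Fin d → 𝔸ˣ) := by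
    have h := hR.mono fun U hU => hU.2
    exact h
  have h1T : (1 : Site d → Fin d → 𝔸ˣ) ∈ 𝒰 ∩ T :=
    ⟨h1, regularPrimePer_one τ hη hL hτt hτp hP ha0 hj₀ haj₀ (hΛ j₀ hj₀) hne⟩
  -- the engine on `𝒰 ∩ T`
  have hlin : ∀ U₀ ∈ 𝒰 ∩ T, LinearOnDomAt i.η (opsAllZdPer τ L P ΛbP ops₀ M i m) (Set.univ : Set (Site d)) U₀ :=
    fun U₀ hU₀ => linearOnDomAt_opsAllZdPer_univ τ P hL2 ΛbP ops₀ M i m hbox (hunit U₀ hU₀.1)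
  have hcont : ∀ A ∈ domSubHPer (d := d) (𝔸 := 𝔸) P, ∀ (y : Site d) (μ : Fin d),
      ContinuousWithinAt (fun U₀ => deltaAOf i.η (opsAllZdPer τ L P ΛbP ops₀ M i m) U₀ A y μ) (𝒰 ∩ T) 1 :=
    fun A hA y μ => lettersContinuousWithinAt_opsAllZdPer_one τ hτp hτt hτs ΛbP ops₀ M i m a hL hP hΛ h1T (fun U hU => hunit U hU.1)
      (fun U hU => hper U hU.1) (fun U hU => hreg U hU.1) (fun U hU => hT U hU.1) (fun U hU => hU.2) (fun U hU => hinj U hU.1) hA y μ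
  have hev := bondPairPer_pos_eventually_domSubHPer τ h1T hlin hcont hpos1
  rwa [nhdsWithin_inter_of_mem' hTmem] at hev

include hτp hτt hτs in
/-- ★★★ **(3.27) ON THE TORUS NEAR THE FLAT BACKGROUND: `G_𝔤^per(U₀) = (Δ_a(U₀))⁻¹` EXISTS FOR THE GENUINE RECORD** — under the hypotheses of
`bondPairPer_pos_eventually_one_opsAllZdPer` (plus the level-periodic class sections `ΛbP` of the `Q*aQ` letter), `RegularAtHPer i.η (opsAllZdPer …) P U₀` for all
`U₀ ∈ 𝒰` near `1` — the content of the junction's `InvAtHIPer` binder at those backgrounds (dag-n06-b's `regularAtHPer_opsAllZdPer_of_pos` door, pointwise).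
[cite: Balaban1985BackgroundPropagators, Thm 3.11 p.416, (3.26)–(3.27) p.395; Balaban1985RegularSpaces, (1.58) p.86, p.77 («Ω_j = T_η»)] -/
theorem regularAtHPer_eventually_one_opsAllZdPer (hL2 : 2 ≤ L) (ΛbP : ℕ → ℕ → Set (Site d × Fin d))
    (ops₀ : ℝ → ZdIdx d L → ℕ → OpsZd d 𝔸) (M : ℝ) (i : ZdIdx d L) (m : ℕ) (hη : i.η ≠ 0) (hP : L ^ m ∣ P)
    (hΛ : ∀ j, j ≤ m → IsPeriodic (P / L ^ j) fun y => y ∈ i.Λs m j) {j₀ : ℕ} (hj₀ : j₀ ≤ m) (hne : (i.Λs m j₀).Nonempty)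
    (hΛb : ∀ j, j ≤ m → ∀ κ : Fin d, IsPeriodic (P / L ^ j) (fun z => (z, κ) ∈ ΛbP m j))
    (hbox : ∀ j, 1 ≤ j → j ≤ m → ∀ c ∈ ΛbP m j, ∀ x, InBox (loK L j c.1) (bondHiK L j c.1 c.2) x → x ∈ i.Ω (j - 1))
    {𝒰 : Set (Site d → Fin d → 𝔸ˣ)} (h1 : (1 : Site d → Fin d → 𝔸ˣ) ∈ 𝒰)
    (hunit : ∀ U₀ ∈ 𝒰, ∀ (x : Site d) (κ : Fin d), U₀ x κ ∈ unitaryUnits 𝔸) (hper : ∀ U₀ ∈ 𝒰, IsPeriodic P U₀)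
    (hreg : ∀ U₀ ∈ 𝒰, Reg17 L m i.Ω (alphaQ d L / (L : ℝ) ^ 2) U₀)
    (hT : ∀ U₀ ∈ 𝒰, ∀ j, j ≤ m → ∀ (x y : Site d), bgT L U₀ j x y ∈ unitaryUnits 𝔸)
    (hinj : ∀ U₀ ∈ 𝒰, QprimeStarPerInjective (𝔸 := 𝔸) (d := d) P L U₀ m (i.Λs m))
    (hpos1 : ∀ A ∈ domSubHPer (d := d) (𝔸 := 𝔸) P, A ≠ 0 → 0 < bondPairPer τ P A (deltaAOf i.η (opsAllZdPer τ L P ΛbP ops₀ M i m) 1 A)) :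
    ∀ᶠ U₀ in 𝓝[𝒰] (1 : Site d → Fin d → 𝔸ˣ), RegularAtHPer i.η (opsLandauPer τ P (withDpZd (withQQP τ L ΛbP ops₀)) M i m) P U₀ := by
  have hev := bondPairPer_pos_eventually_one_opsAllZdPer τ hτp hτt hτs hL2 ΛbP ops₀ M i m hη hP hΛ hj₀ hne hbox h1 hunit hper hreg hT hinj hpos1
  filter_upwards [hev, eventually_mem_nhdsWithin] with U₀ hU₀ hU𝒰
  exact regularAtHPer_opsAllZdPer_of_pos τ P hL2 hτp hτt hτs ΛbP ops₀ M i (hunit U₀ hU𝒰) (hper U₀ hU𝒰) hP hΛb hbox hU₀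

include hτp hτt hτs in
/-- ★★★ **THE SUP-NORM READING** (print's small-field classes): under the hypotheses of `regularAtHPer_eventually_one_opsAllZdPer` there is `δ > 0` such that
`RegularAtHPer` — `G_𝔤^per(U₀) = (Δ_a(U₀))⁻¹` exists for the genuine periodic record — holds at EVERY `U₀ ∈ 𝒰` with `‖U₀(b) − 1‖ < δ` at every bond (g3's
`exists_delta_of_eventually_nhdsWithin`). [cite: Balaban1985BackgroundPropagators, Thm 3.11 p.416 («for U satisfying (3.35)»), (3.35) p.396, (3.27) p.395] -/
theorem exists_delta_regularAtHPer_opsAllZdPer (hL2 : 2 ≤ L) (ΛbP : ℕ → ℕ → Set (Site d × Fin d))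
    (ops₀ : ℝ → ZdIdx d L → ℕ → OpsZd d 𝔸) (M : ℝ) (i : ZdIdx d L) (m : ℕ) (hη : i.η ≠ 0) (hP : L ^ m ∣ P)
    (hΛ : ∀ j, j ≤ m → IsPeriodic (P / L ^ j) fun y => y ∈ i.Λs m j) {j₀ : ℕ} (hj₀ : j₀ ≤ m) (hne : (i.Λs m j₀).Nonempty)
    (hΛb : ∀ j, j ≤ m → ∀ κ : Fin d, IsPeriodic (P / L ^ j) (fun z => (z, κ) ∈ ΛbP m j))
    (hbox : ∀ j, 1 ≤ j → j ≤ m → ∀ c ∈ ΛbP m j, ∀ x, InBox (loK L j c.1) (bondHiK L j c.1 c.2) x → x ∈ i.Ω (j - 1))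
    {𝒰 : Set (Site d → Fin d → 𝔸ˣ)} (h1 : (1 : Site d → Fin d → 𝔸ˣ) ∈ 𝒰)
    (hunit : ∀ U₀ ∈ 𝒰, ∀ (x : Site d) (κ : Fin d), U₀ x κ ∈ unitaryUnits 𝔸) (hper : ∀ U₀ ∈ 𝒰, IsPeriodic P U₀)
    (hreg : ∀ U₀ ∈ 𝒰, Reg17 L m i.Ω (alphaQ d L / (L : ℝ) ^ 2) U₀)
    (hT : ∀ U₀ ∈ 𝒰, ∀ j, j ≤ m → ∀ (x y : Site d), bgT L U₀ j x y ∈ unitaryUnits 𝔸)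
    (hinj : ∀ U₀ ∈ 𝒰, QprimeStarPerInjective (𝔸 := 𝔸) (d := d) P L U₀ m (i.Λs m))
    (hpos1 : ∀ A ∈ domSubHPer (d := d) (𝔸 := 𝔸) P, A ≠ 0 → 0 < bondPairPer τ P A (deltaAOf i.η (opsAllZdPer τ L P ΛbP ops₀ M i m) 1 A)) :
    ∃ δ : ℝ, 0 < δ ∧ ∀ U₀ ∈ 𝒰, (∀ (y : Site d) (μ : Fin d), ‖(U₀ y μ : 𝔸) - 1‖ < δ) →
      RegularAtHPer i.η (opsLandauPer τ P (withDpZd (withQQP τ L ΛbP ops₀)) M i m) P U₀ := by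
  have h := B9Thm311PosDefOpenZd.exists_delta_of_eventually_nhdsWithin
    (regularAtHPer_eventually_one_opsAllZdPer τ hτp hτt hτs hL2 ΛbP ops₀ M i m hη hP hΛ hj₀ hne hΛb hbox h1 hunit hper hreg hT hinj hpos1)
  obtain ⟨δ, hδ, hP'⟩ := h
  refine ⟨δ, hδ, fun U₀ hU₀ hclose => hP' U₀ hU₀ fun y μ => ?_⟩
  simpa only [Pi.one_apply, Units.val_one] using hclose y μ

end NearFlat


/-! ## §5  At the torus member of record: the geometric hypotheses discharged -/

section TorusMember

open B8Thm4TorusAt (torusLam mem_torusLam_iff torusLam_self)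
open B8Thm2TorusMember (TorusMember torusIdx torusLamb)

variable [FiniteDimensional ℝ 𝔸] [Nontrivial 𝔸] (τ : 𝔸 →ₗ[ℂ] ℂ) (hτp : ∀ a : 𝔸, a ≠ 0 → 0 < (τ (star a * a)).re)
  (hτt : ∀ a b : 𝔸, τ (a * b) = τ (b * a)) (hτs : ∀ a : 𝔸, τ (star a) = starRingEnd ℂ (τ a)) {L P : ℕ} [NeZero P] [NeZero L]

include hτp hτt hτs in
/-- ★★★ **AT THE TORUS MEMBER `torusIdx` (`Ω_j = ℤᵈ`, constraint sets `torusLam m`: none below the top level `m`, every top-level site; constraint bonds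
`torusLamb`): the level-periodicity, non-emptiness, `Q′*`-injectivity (one active level) and box-law hypotheses of §4 hold with NO condition, so Thm 3.11 ∕ (3.27)
near the flat background for the genuine periodic record at the torus member needs only the regime set (`1 ∈ 𝒰`: unitary, `P`-periodic, `Reg17`, `Ū₀ʲ(Γ)` unitary for
`j ≤ m`), `2 ≤ L` and `Lᵐ ∣ P` — the flat positivity of the genuine periodic `Δ_a(1)` on `E_𝔤^per(P)` being dag-n06-b g23's
`B9Thm311FlatPositivityZdPer.bondPairPer_deltaAOf_opsAllZdPer_one_pos` (all-torus classes), cited BY NAME.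
[cite: Balaban1985BackgroundPropagators, Thm 3.11 p.416, (3.26)–(3.27) p.395; Balaban1985RegularSpaces, (1.28) p.81, (1.37) p.82, p.77 («Ω_j = T_η»)] -/
theorem regularAtHPer_eventually_one_torusIdx (hL2 : 2 ≤ L) (t : TorusMember) (ops₀ : ℝ → ZdIdx d L → ℕ → OpsZd d 𝔸) (M : ℝ) (m : ℕ)
    (hP : L ^ m ∣ P) {𝒰 : Set (Site d → Fin d → 𝔸ˣ)} (h1 : (1 : Site d → Fin d → 𝔸ˣ) ∈ 𝒰)
    (hunit : ∀ U₀ ∈ 𝒰, ∀ (x : Site d) (κ : Fin d), U₀ x κ ∈ unitaryUnits 𝔸) (hper : ∀ U₀ ∈ 𝒰, IsPeriodic P U₀)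
    (hreg : ∀ U₀ ∈ 𝒰, Reg17 L m (torusIdx (d := d) (le_trans (by norm_num) hL2) t).Ω (alphaQ d L / (L : ℝ) ^ 2) U₀)
    (hT : ∀ U₀ ∈ 𝒰, ∀ j, j ≤ m → ∀ (x y : Site d), bgT L U₀ j x y ∈ unitaryUnits 𝔸) :
    ∀ᶠ U₀ in 𝓝[𝒰] (1 : Site d → Fin d → 𝔸ˣ),
      RegularAtHPer t.η (opsLandauPer τ P (withDpZd (withQQP τ L (fun m => torusLamb m) ops₀)) M (torusIdx (d := d) (le_trans (by norm_num) hL2) t) m) P U₀ := by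
  have hL1 : 1 ≤ L := le_trans (by norm_num) hL2
  set i : ZdIdx d L := torusIdx (d := d) hL1 t with hi
  have hiΛ : i.Λs m = torusLam (d := d) m := rfl
  have hiΩ : ∀ j, i.Ω j = Set.univ := fun _ => rfl
  have hiη : i.η = t.η := rfl
  -- the geometric hypotheses at the torus member
  have hΛ : ∀ j, j ≤ m → IsPeriodic (P / L ^ j) fun y => y ∈ i.Λs m j := by
    intro j _ y n
    show (y + ((P / L ^ j : ℕ) : ℤ) • n ∈ i.Λs m j) = (y ∈ i.Λs m j)
    rw [hiΛ, mem_torusLam_iff, mem_torusLam_iff]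
  have hne : (i.Λs m m).Nonempty := by
    rw [hiΛ, torusLam_self]
    exact Set.univ_nonempty
  have hΛb : ∀ j, j ≤ m → ∀ κ : Fin d, IsPeriodic (P / L ^ j) (fun z => (z, κ) ∈ (fun m => torusLamb (d := d) m) m j) := by
    intro j _ κ z n
    show ((z + ((P / L ^ j : ℕ) : ℤ) • n, κ) ∈ torusLamb (d := d) m j) = ((z, κ) ∈ torusLamb (d := d) m j)
    rw [B8Thm2TorusMember.mem_torusLamb_iff, B8Thm2TorusMember.mem_torusLamb_iff]
  have hbox : ∀ j, 1 ≤ j → j ≤ m → ∀ c ∈ (fun m => torusLamb (d := d) m) m j, ∀ x, InBox (loK L j c.1) (bondHiK L j c.1 c.2) x → x ∈ i.Ω (j - 1) :=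
    fun j _ _ _ _ x _ => by rw [hiΩ]; exact Set.mem_univ x
  have hinj : ∀ U₀ ∈ 𝒰, QprimeStarPerInjective (𝔸 := 𝔸) (d := d) P L U₀ m (i.Λs m) := by
    intro U₀ _
    refine B9Eq325QGGQInvZdPer.qprimeStarPerInjective_of_single_level hP le_rfl fun j _ hjm y hsat => hjm ?_
    unfold B9Eq325QGGQInvZdPer.InSat at hsat
    rw [hiΛ, mem_torusLam_iff] at hsat
    exact hsat
  -- the flat positivity of the genuine periodic `Δ_a(1)` at the torus member: dag-n06-b's `B9Thm311FlatPositivityZdPer`, BY NAME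
  have hpos1 : ∀ A ∈ domSubHPer (d := d) (𝔸 := 𝔸) P, A ≠ 0 →
      0 < bondPairPer τ P A (deltaAOf i.η (opsAllZdPer τ L P (fun m => torusLamb (d := d) m) ops₀ M i m) 1 A) :=
    fun A hA hA0 => B9Thm311FlatPositivityZdPer.bondPairPer_deltaAOf_opsAllZdPer_one_pos τ P hτt hτs hτp hL2 ops₀ M i hiΛ rfl hP hA hA0
  have h := regularAtHPer_eventually_one_opsAllZdPer τ hτp hτt hτs hL2 (fun m => torusLamb (d := d) m) ops₀ M i m
    (by rw [hiη]; exact t.hη.ne') hP hΛ le_rfl hne hΛb hbox h1 hunit hper hreg hT hinj hpos1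
  rw [hiη] at h
  exact h

end TorusMember

/-! ## §6  (v1.1) The canonical regime set of the torus member: no displayed binder left -/

section Canonical

open B8Thm4TorusAt (torusLam)
open B8Thm2TorusMember (TorusMember torusIdx torusLamb)
open B9Eq316AveragingTransposeZd (reg17_one alphaQ_pos)

variable [FiniteDimensional ℝ 𝔸] [Nontrivial 𝔸] (τ : 𝔸 →ₗ[ℂ] ℂ) (hτp : ∀ a : 𝔸, a ≠ 0 → 0 < (τ (star a * a)).re)
  (hτt : ∀ a b : 𝔸, τ (a * b) = τ (b * a)) (hτs : ∀ a : 𝔸, τ (star a) = starRingEnd ℂ (τ a)) {L P : ℕ} [NeZero P] [NeZero L]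

include hτp hτt hτs in
/-- ★★★ **THM 3.11 ∕ (3.27) NEAR THE FLAT BACKGROUND AT THE TORUS MEMBER, CANONICAL REGIME SET — NO DISPLAYED BINDER**: for `2 ≤ L`, `Lᵐ ∣ P` and a faithful Hermitian
tracial `τ` on a finite-dimensional fibre, `RegularAtHPer` — «`G_𝔤^per(U₀) = (Δ_a(U₀))⁻¹` exists» for the genuine periodic record at `torusIdx` — holds for all `U₀` NEAR `1`
WITHIN the canonical regime set `{U₀ unitary, P-periodic, in the class (1.7) of the member at truncation m (α = α_Q∕L²), Ū₀ʲ(Γ) unitary for j ≤ m}` (which contains `1`: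
`reg17_one`, `bgT_one`).  [cite: Balaban1985BackgroundPropagators, Thm 3.11 p.416, (3.26)–(3.27) p.395; Balaban1985RegularSpaces, (1.7) p.77, (1.58) p.86, p.77 («Ω_j = T_η»)] -/
theorem regularAtHPer_eventually_one_torusIdx_canonical (hL2 : 2 ≤ L) (t : TorusMember) (ops₀ : ℝ → ZdIdx d L → ℕ → OpsZd d 𝔸) (M : ℝ) (m : ℕ)
    (hP : L ^ m ∣ P) :
    ∀ᶠ U₀ in 𝓝[{U₀ : Site d → Fin d → 𝔸ˣ | (∀ (x : Site d) (κ : Fin d), U₀ x κ ∈ unitaryUnits 𝔸) ∧ IsPeriodic P U₀ ∧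
        Reg17 L m (torusIdx (d := d) (le_trans (by norm_num) hL2) t).Ω (alphaQ d L / (L : ℝ) ^ 2) U₀ ∧
        ∀ j, j ≤ m → ∀ (x y : Site d), bgT L U₀ j x y ∈ unitaryUnits 𝔸}] (1 : Site d → Fin d → 𝔸ˣ),
      RegularAtHPer t.η (opsLandauPer τ P (withDpZd (withQQP τ L (fun m => torusLamb m) ops₀)) M (torusIdx (d := d) (le_trans (by norm_num) hL2) t) m) P U₀ := by
  have hL1 : 1 ≤ L := le_trans (by norm_num) hL2
  have hL0 : (0 : ℝ) < L := by exact_mod_cast (lt_of_lt_of_le (by norm_num) hL2)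
  refine regularAtHPer_eventually_one_torusIdx τ hτp hτt hτs hL2 t ops₀ M m hP ⟨?_, ?_, ?_, ?_⟩ (fun U₀ hU₀ => hU₀.1) (fun U₀ hU₀ => hU₀.2.1)
    (fun U₀ hU₀ => hU₀.2.2.1) (fun U₀ hU₀ => hU₀.2.2.2)
  · exact fun _ _ => (unitaryUnits 𝔸).one_mem
  · exact fun _ _ => rfl
  · exact reg17_one hL1 (div_pos (alphaQ_pos d hL1) (pow_pos hL0 2))
  · intro j _ x y
    rw [B8Eq119TwistedAxial.bgT_one]
    exact (unitaryUnits 𝔸).one_mem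

include hτp hτt hτs in
/-- ★★★ **THE SUP-NORM READING AT THE TORUS MEMBER, CANONICAL REGIME SET**: there is `δ > 0` (depending on the member, `P`, `τ`, `ops₀`, `M`, `m`) such that EVERY unitary
`P`-periodic `U₀` in the class (1.7) of the member with `Ū₀ʲ(Γ)` unitary for `j ≤ m` and `‖U₀(b) − 1‖ < δ` at every bond has `RegularAtHPer` for the genuine periodic
record at `torusIdx` — «for U satisfying (3.35)» with a member-dependent `δ` in place of print's uniform `α₀′`.
[cite: Balaban1985BackgroundPropagators, Thm 3.11 p.416 («for U satisfying (3.35)»), (3.35) p.396, (3.27) p.395; Balaban1985RegularSpaces, (1.7) p.77] -/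
theorem exists_delta_regularAtHPer_torusIdx_canonical (hL2 : 2 ≤ L) (t : TorusMember) (ops₀ : ℝ → ZdIdx d L → ℕ → OpsZd d 𝔸) (M : ℝ) (m : ℕ)
    (hP : L ^ m ∣ P) :
    ∃ δ : ℝ, 0 < δ ∧ ∀ U₀ : Site d → Fin d → 𝔸ˣ, (∀ (x : Site d) (κ : Fin d), U₀ x κ ∈ unitaryUnits 𝔸) → IsPeriodic P U₀ →
      Reg17 L m (torusIdx (d := d) (le_trans (by norm_num) hL2) t).Ω (alphaQ d L / (L : ℝ) ^ 2) U₀ →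
      (∀ j, j ≤ m → ∀ (x y : Site d), bgT L U₀ j x y ∈ unitaryUnits 𝔸) → (∀ (y : Site d) (μ : Fin d), ‖(U₀ y μ : 𝔸) - 1‖ < δ) →
      RegularAtHPer t.η (opsLandauPer τ P (withDpZd (withQQP τ L (fun m => torusLamb m) ops₀)) M (torusIdx (d := d) (le_trans (by norm_num) hL2) t) m) P U₀ := by
  obtain ⟨δ, hδ, h⟩ := B9Thm311PosDefOpenZd.exists_delta_of_eventually_nhdsWithin
    (regularAtHPer_eventually_one_torusIdx_canonical τ hτp hτt hτs hL2 t ops₀ M m hP)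
  refine ⟨δ, hδ, fun U₀ hu hper hreg hT hclose => h U₀ ⟨hu, hper, hreg, hT⟩ fun y μ => ?_⟩
  simpa only [Pi.one_apply, Units.val_one] using hclose y μ

end Canonical

end Literature.MathematicalPhysics.QuantumFieldTheory.Balaban1983to89.B9Thm311PosDefOpenZdPer

end
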